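import Literature.NumberTheory.LFunctions.ZetaZeroInvSqLimit
import Literature.NumberTheory.LFunctions.ZetaZeroHarmonicLimitNumerics
import HarnessLib

/-!
# RH-FREE — `c₁ = Σ_{γ>0} 1/γ²` in the kernel's arithmetic: `|c₁ − 0.0231049931| ≤ 4·10⁻¹⁰` from the tree's certified first `2000` zeros, and `|E₂(T)| ≤ (4.575 + 0.118 log T)/T³` for `T > 168π` with NO named fact (Brent–Platt–Trudgian 2021, Math. Comp. 90, Example 1 / Corollary 1) («nothing here bears on the truth of RH»)

Topic `Literature/NumberTheory/LFunctions` (RH literature-typing tranche 1, L4 "explicit zero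
statistics", gen 7; computational lane: Turing's method with Trudgian's constants
(`abs_integral_zetaArgS_le_trudgian_holds`), the certified brackets of the first `2000` zeros
(`SchoenfeldZerosLow.lean`), and the kernel logarithm of `ZetaZeroHarmonicLimitNumerics.lean` are
`native_decide` certificates declared to the gate). Label: **RH-FREE**. THEOREMS only (the four `def`s
are integer bookkeeping); NO named fact. Nothing here bears on the truth of RH.

Source: R. P. Brent, D. J. Platt, T. S. Trudgian, *Accurate estimation of sums over zeros of the Riemann
zeta-function*, Math. Comp. 90 (2021) 2923–2935 = arXiv:2009.13791, §4 Example 1 ("taking `T = 1000`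
… `|E₂(T)| ≤ 9.965·10⁻⁹`; if we use `10¹⁰` zeros … the improvement is by a factor of `3·10⁹`") and
Corollary 1 (`c₁ = 0.0231049931154189707889338104 + ϑ(5·10⁻²⁸)`, the named fact
`BrentPlattTrudgian2021_cor1`) `[corpus:paper:arxiv-2009.13791 p0006]`; the constant and the identity
`c₁ = Σ_{0<γ≤T} m/γ² + (log(T/2π)+1)/(2πT) − Q(T)/T² + 2∫_T^∞ Q/t³` are the companion file
`ZetaZeroInvSqLimit.lean` (`zetaZeroInvSqLimit`, `zetaZeroInvSqLimit_eq_at`).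

## What is proved

* `abs_two_mul_integral_Ioi_count_sub_countMain_div_cube_le` — for `T > 168π`,
  **`|E₂(T)| = |2∫_T^∞ Q/t³| ≤ (4.575 + 0.118 log T)/T³` with NO named fact** (the bound (1.3) with base
  point `a = T`, Trudgian 2011 Thm 2.2 and the tree's `|Q − S| ≤ 1.2/(πt)`; the printed
  `(8.334 + 0.236 log T)/T³` needs the "small computation" on `[2π, 168π]`).
* `InvSqLimitNumerics.abs_zetaZeroInvSqLimit_sub_le` — **`|c₁ − 0.0231049931| ≤ 4·10⁻¹⁰`**: the identity
  at `T = 2516` (`N(2516) = 2000`, `zerosBetween_zero_heightT0`) with `Σ_{j<2000} 1/γ_j²` enclosed at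
  scale `2⁸⁰` from the certified brackets (`invOrdSqSumLo/Hi`, one `native_decide`),
  `log 2516 ∈ [7.8304256178, 7.8304256179]` (`HarmonicLimitNumerics.log_2516_bounds`), `log 2`, `log π`,
  `π` to 20 digits, and `|E₂(2516)| ≤ 3.46·10⁻¹⁰`; nine significant digits of the source's `c₁` are thus
  confirmed in the kernel (`BrentPlattTrudgian2021_cor1.consistent`). Consequence with no named fact:
  `sum_inv_sq_lt : Σ_{0<γ≤U} m(ρ)/γ² < 0.0231049936` for every `U`.
* `sum_inv_sq_tail_le_explicit`, `sum_inv_sq_tail_le_unconditional` — **Brent–Platt–Trudgian 2022,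
  Lemma 5, `Σ_{T<γ≤U} m(ρ)/γ² ≤ log T/(2πT)`, with NO named fact for `T > 168π`** (the tree's
  `BrentPlattTrudgian2022_cor1.sum_inv_sq_le` has it from `2πe` modulo `|N − L| ≤ 0.28 log T`), and the
  sharper `≤ (log(T/2π) + 1)/(2πT) + (0.3083 log T + 3.253)/T² + (4.575 + 0.118 log T)/T³`.

## References

* R. P. Brent, D. J. Platt, T. S. Trudgian, Math. Comp. 90 (2021) 2923–2935, §4 Example 1, Cor. 1.
  [BrentPlattTrudgian2021]
* R. P. Brent, D. J. Platt, T. S. Trudgian, J. Number Theory 238 (2022) 740–762, Lemma 5.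
  [BrentPlattTrudgian2022]
* T. S. Trudgian, Math. Comp. 80 (2011) 2259–2279, Thm 2.2. [Trudgian2011]
* A. M. Odlyzko, H. J. J. te Riele, J. reine angew. Math. 357 (1985), §4.2 (the first `2000` zeros; the
  tree's certificate). [OdlyzkoTeRiele1985]
-/

noncomputable section

open Complex Filter Set MeasureTheory intervalIntegral
open scoped Real Topology

namespace Literature.NumberTheory.LFunctions

open SchoenfeldBound

/-! ## `E₂(T)` for `φ = 1/t²` beyond `168π`, with no named fact -/

/-- **A fact-free bound for `E₂(T) = 2∫_T^∞ Q/t³` beyond `168π`**: for `T > 168π`,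
`|2∫_T^∞ Q/t³| ≤ (4.575 + 0.118 log T)/T³` (the bound (1.3) with the base point `T`: Trudgian 2011,
Thm. 2.2 = `abs_integral_zetaArgS_le_trudgian_holds`, and `A₂ = 1.2/π`).
[cite: BrentPlattTrudgian2021, §4 Example 1] [cite: Trudgian2011, Thm. 2.2] -/
theorem abs_two_mul_integral_Ioi_count_sub_countMain_div_cube_le {T : ℝ} (hT : 168 * π < T) :
    |2 * ∫ t in Ioi T, ((zetaZeroCount t : ℝ) - countMain t) / t ^ 3| ≤
      (4.575 + 0.118 * Real.log T) / T ^ 3 := by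
  have hπ : 3 < π := Real.pi_gt_three
  have hπ4 : 3.1415 < π := Real.pi_gt_d4
  have hT0 : 0 < T := by linarith
  have h3 : (3 : ℝ) ≤ T := by linarith
  have hlogT : 0 ≤ Real.log T := Real.log_nonneg (by linarith)
  have hTr := abs_integral_zetaArgS_le_trudgian_holds
  have hS1 : ∀ t ∈ Ici T, |∫ x in T..t, zetaArgS x| ≤ 2.067 + 0.059 * Real.log t := by
    intro t ht
    rcases eq_or_lt_of_le (show T ≤ t from ht) with h | h
    · rw [← h, intervalIntegral.integral_same, abs_zero]
      positivity
    · exact hTr hT h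
  have hQS : ∀ t ∈ Ici T, |((zetaZeroCount t : ℝ) - countMain t) - zetaArgS t| ≤ (1.2 / π) / t :=
    fun t ht ↦ abs_count_sub_countMain_sub_zetaArgS_le (by linarith [(show T ≤ t from ht)])
  have h := BrentPlattTrudgian2021_thm1_E2_base h3 (by norm_num : (0 : ℝ) ≤ 0.059)
    (BPT2021.hasDerivAt_one_div_sq hT0) (BPT2021.hasDerivAt_neg_two_div_cube hT0)
    (BPT2021.continuousOn_six_div_pow_four hT0) (fun t ht ↦ by have := hT0.trans_le ht; positivity)
    (fun t ht ↦ by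
      have := hT0.trans_le ht
      exact div_nonpos_of_nonpos_of_nonneg (by norm_num) (by positivity))
    (fun t ht ↦ by have := hT0.trans_le ht; positivity) (BPT2021.integrableOn_one_div_sq_div hT0) hS1 hQS
  rw [BPT2021.integral_Ioi_mul_neg_two_div_cube, abs_neg, intervalIntegral.integral_same, abs_zero,
    zero_add] at h
  have e1 : |(-2 : ℝ) / T ^ 3| = 2 / T ^ 3 := by
    rw [neg_div, abs_neg, abs_of_pos (by positivity)]
  rw [e1] at h
  refine h.trans ?_
  have hA₂ : 1.2 / π ≤ 0.382 := by
    rw [div_le_iff₀ (by positivity)]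
    linarith
  rw [show (2.067 + 0.059 * Real.log T) * (2 / T ^ 3) + (0.059 + 1.2 / π) * (1 / T ^ 2) / T =
      (2 * (2.067 + 0.059 * Real.log T) + (0.059 + 1.2 / π)) / T ^ 3 by field_simp]
  apply div_le_div_of_nonneg_right _ (by positivity)
  linarith

/-! ## BPT 2022 Lemma 5 (`Σ_{γ>T} 1/γ² ≤ log T/(2πT)`) with no named fact, for `T > 168π` -/

/-- Tail sums are non-decreasing in the upper limit. [cite: BrentPlattTrudgian2022, Lemma 5] -/
theorem monotone_sum_inv_sq_tail (T : ℝ) (hT : 0 ≤ T) :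
    Monotone fun U : ℝ ↦ ∑ ρ ∈ zerosBetween T U, (riemannZetaZeroOrder ρ : ℝ) * (1 / ρ.im ^ 2) := by
  intro U U' h
  have hsub : zerosBetween T U ⊆ zerosBetween T U' := by
    intro ρ hρ
    obtain ⟨hz, h0, h1, h3, h4⟩ := (mem_zerosBetween hT).1 hρ
    exact (mem_zerosBetween hT).2 ⟨hz, h0, h1, h3, h4.trans h⟩
  show ∑ ρ ∈ zerosBetween T U, (riemannZetaZeroOrder ρ : ℝ) * (1 / ρ.im ^ 2) ≤
    ∑ ρ ∈ zerosBetween T U', (riemannZetaZeroOrder ρ : ℝ) * (1 / ρ.im ^ 2)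
  refine Finset.sum_le_sum_of_subset_of_nonneg hsub fun ρ hρ _ ↦ ?_
  exact mul_nonneg (zeroOrder_nonneg_of_mem_zerosBetween hT hρ) (by positivity)

/-- **The tail `Σ_{T<γ≤U} m(ρ)/γ²` with NO named fact**, for `T > 168π` and every `U`:
`≤ (log(T/2π) + 1)/(2πT) + (0.3083 log T + 3.253)/T² + (4.575 + 0.118 log T)/T³` (the limit of
Example 1, the tree's proved Backlund-type `|Q(T)| ≤ 0.3083 log T + 3.253`, and the fact-free `E₂`
bound). [cite: BrentPlattTrudgian2021, §4 Example 1] [cite: BrentPlattTrudgian2022, Lemma 5] -/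
theorem sum_inv_sq_tail_le_explicit {T U : ℝ} (hT : 168 * π < T) :
    ∑ ρ ∈ zerosBetween T U, (riemannZetaZeroOrder ρ : ℝ) * (1 / ρ.im ^ 2) ≤
      (Real.log (T / (2 * π)) + 1) / (2 * π * T) + (0.3083 * Real.log T + 3.253) / T ^ 2
        + (4.575 + 0.118 * Real.log T) / T ^ 3 := by
  have hπ : 3 < π := Real.pi_gt_three
  have hT0 : 0 < T := by linarith
  have h2π : 2 * π ≤ T := by linarith
  have hlim := BrentPlattTrudgian2021_example1_tendsto h2π
  have hle := (monotone_sum_inv_sq_tail T hT0.le).ge_of_tendsto hlim U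
  have hE := abs_two_mul_integral_Ioi_count_sub_countMain_div_cube_le hT
  have hQ := abs_count_sub_countMain_le_backlund (by linarith : (30 : ℝ) ≤ T)
  unfold FKS2023.countErr at hQ
  rw [abs_le] at hE hQ
  have hQ' : -(((zetaZeroCount T : ℝ) - countMain T) / T ^ 2) ≤ (0.3083 * Real.log T + 3.253) / T ^ 2 := by
    rw [← neg_div]
    apply div_le_div_of_nonneg_right _ (by positivity)
    have : 0 * Real.log (Real.log T) = 0 := zero_mul _
    linarith [hQ.1]
  refine hle.trans ?_
  linarith [hE.2]

/-- **Brent–Platt–Trudgian 2022, Lemma 5 (`Σ_{γ>T} 1/γ² ≤ log T/(2πT)`) with NO named fact, for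
`T > 168π`** (the tree's `BrentPlattTrudgian2022_cor1.sum_inv_sq_le` gives it from `T ≥ 2πe` modulo
the fact `|N − L| ≤ 0.28 log T`): for every `U`, `Σ_{T<γ≤U} m(ρ)/γ² ≤ log T/(2πT)`
(`(1 − log 2π)/(2π) < −0.133` absorbs the error terms beyond `168π`).
[cite: BrentPlattTrudgian2022, Lemma 5] -/
theorem sum_inv_sq_tail_le_unconditional {T U : ℝ} (hT : 168 * π < T) :
    ∑ ρ ∈ zerosBetween T U, (riemannZetaZeroOrder ρ : ℝ) * (1 / ρ.im ^ 2) ≤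
      Real.log T / (2 * π * T) := by
  have hπ : 3 < π := Real.pi_gt_three
  have hπ' : π < 3.15 := Real.pi_lt_d2
  have hT0 : 0 < T := by linarith
  have hT500 : 500 < T := by linarith
  have h := sum_inv_sq_tail_le_explicit (U := U) hT
  refine h.trans ?_
  have hl2 := Real.log_two_gt_d9
  have hlπ : 1.1447298858494001 < Real.log π := by
    linarith [Literature.Analysis.SpecialFunctions.Real.log_pi_gt_d20]
  rw [Real.log_div hT0.ne' (by positivity), Real.log_mul (by norm_num) (by positivity)]
  -- `log T ≤ T/75` for `T ≥ 500` (`log T ≤ log 500 + T/500 − 1`, `log 500 < 6.3`)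
  have hlogT : Real.log T ≤ T / 75 := by
    have h1 : Real.log T ≤ Real.log 500 + (T / 500 - 1) := by
      have := Real.log_le_sub_one_of_pos (show 0 < T / 500 by positivity)
      have e : Real.log (T / 500) = Real.log T - Real.log 500 := Real.log_div hT0.ne' (by norm_num)
      linarith
    have h500 : Real.log 500 < 6.3 := by
      rw [Real.log_lt_iff_lt_exp (by norm_num)]
      have h6 : Real.exp 6.3 = Real.exp 1 ^ 6 * Real.exp 0.3 := by
        rw [Real.exp_one_pow, ← Real.exp_add]; congr 1; norm_num
      have he : (2.7182818283 : ℝ) ^ 6 ≤ Real.exp 1 ^ 6 :=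
        pow_le_pow_left₀ (by norm_num) Real.exp_one_gt_d9.le 6
      have h22 : (1.3 : ℝ) ≤ Real.exp 0.3 := by
        have := Real.add_one_le_exp (0.3 : ℝ); linarith
      rw [h6]; nlinarith
    linarith
  have hlog0 : 0 ≤ Real.log T := Real.log_nonneg (by linarith)
  -- the three pieces
  have h1 : (Real.log T - (Real.log 2 + Real.log π) + 1) / (2 * π * T) ≤
      (Real.log T - 0.8378) / (2 * π * T) :=
    div_le_div_of_nonneg_right (by linarith) (by positivity)
  have h2 : (0.3083 * Real.log T + 3.253) / T ^ 2 ≤ 0.011 / T := by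
    rw [div_le_div_iff₀ (by positivity) hT0]
    nlinarith
  have h3 : (4.575 + 0.118 * Real.log T) / T ^ 3 ≤ 0.001 / T := by
    rw [div_le_div_iff₀ (by positivity) hT0]
    nlinarith [mul_pos hT0 hT0]
  have h4 : (0.012 : ℝ) / T ≤ 0.8378 / (2 * π * T) := by
    rw [div_le_div_iff₀ hT0 (by positivity)]
    nlinarith
  have e1 : (Real.log T - 0.8378) / (2 * π * T) = Real.log T / (2 * π * T) - 0.8378 / (2 * π * T) := by
    rw [sub_div]
  have e2 : (0.011 : ℝ) / T + 0.001 / T = 0.012 / T := by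
    rw [← add_div]; norm_num
  linarith

/-! ## `Σ_{j<2000} 1/γ_j²` from the certified brackets, at scale `2⁸⁰` -/

namespace InvSqLimitNumerics

open NicolasJExplicit ZetaNumerics.Mertens MertensCertificate.ZetaNumerics.Mertens
  Literature.NumberTheory.LFunctions.MertensZeroCertificate

/-- `⌊2⁵⁶⁰/a_j²⌋ + 1 ≥ 2⁸⁰ · 2⁴⁸⁰/a_j² = 2⁸⁰/t₁ⱼ²`. [cite: OdlyzkoTeRiele1985, §4.2 p. 151] -/
def invOrdSqTermHi (j : ℕ) : ℕ := 2 ^ 560 / (ordinate j).toNat ^ 2 + 1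

/-- `⌊2⁵⁶⁰/(a_j + 1)²⌋ ≤ 2⁸⁰/t₂ⱼ²`. [cite: OdlyzkoTeRiele1985, §4.2 p. 151] -/
def invOrdSqTermLo (j : ℕ) : ℕ := 2 ^ 560 / ((ordinate j).toNat + 1) ^ 2

/-- `invOrdSqSumLo n = Σ_{j<n} invOrdSqTermLo j`. [cite: OdlyzkoTeRiele1985, §4.2 p. 151] -/
def invOrdSqSumLo : ℕ → ℕ
  | 0 => 0
  | n + 1 => invOrdSqSumLo n + invOrdSqTermLo n

/-- `invOrdSqSumHi n = Σ_{j<n} invOrdSqTermHi j`. [cite: OdlyzkoTeRiele1985, §4.2 p. 151] -/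
def invOrdSqSumHi : ℕ → ℕ
  | 0 => 0
  | n + 1 => invOrdSqSumHi n + invOrdSqTermHi n

/-- `invOrdSqSumLo n = Σ_{j<n} invOrdSqTermLo j`. [cite: OdlyzkoTeRiele1985, §4.2 p. 151] -/
theorem invOrdSqSumLo_eq (n : ℕ) : invOrdSqSumLo n = ∑ j ∈ Finset.range n, invOrdSqTermLo j := by
  induction n with
  | zero => rfl
  | succ n ih => rw [invOrdSqSumLo, ih, Finset.sum_range_succ]

/-- `invOrdSqSumHi n = Σ_{j<n} invOrdSqTermHi j`. [cite: OdlyzkoTeRiele1985, §4.2 p. 151] -/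
theorem invOrdSqSumHi_eq (n : ℕ) : invOrdSqSumHi n = ∑ j ∈ Finset.range n, invOrdSqTermHi j := by
  induction n with
  | zero => rfl
  | succ n ih => rw [invOrdSqSumHi, ih, Finset.sum_range_succ]

/-- **The compiled evaluation**: `invOrdSqSumLo 2000 = 27397468774965814156189` and
`invOrdSqSumHi 2000 = 27397468774965814158189`, whence
`0.02266265500367867088 ≤ Σ_{j<2000} 1/γ_j² ≤ 0.02266265500367867089`. Declared to the gate as
`computational` (`native_decide`). [cite: BrentPlattTrudgian2021, §4 Example 1 ("taking T = 1000 … 649 zeros")] -/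
theorem check_eq :
    2266265500367867088 * 2 ^ 80 ≤ invOrdSqSumLo 2000 * 10 ^ 20 ∧
      invOrdSqSumHi 2000 * 10 ^ 20 ≤ 2266265500367867089 * 2 ^ 80 := by
  native_decide

/-- `(2²⁴⁰)² · 2⁸⁰ = 2⁵⁶⁰` in `ℝ` (powers kept unevaluated). [cite: OdlyzkoTeRiele1985, §4.2 p. 151] -/
private theorem cast_two_pow_560 : ((2 ^ 560 : ℕ) : ℝ) = ((2 : ℝ) ^ 240) ^ 2 * 2 ^ 80 := by
  rw [Nat.cast_pow, Nat.cast_ofNat, ← pow_mul, show (560 : ℕ) = 240 * 2 + 80 from rfl, pow_add]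

/-- `1/t₁ⱼ² ≤ invOrdSqTermHi j / 2⁸⁰`. [cite: OdlyzkoTeRiele1985, §4.2 p. 151] -/
theorem inv_t₁_sq_le {j : ℕ} (hj : j < 2000) : (t₁ j)⁻¹ ^ 2 ≤ (invOrdSqTermHi j : ℝ) / 2 ^ 80 := by
  have h1 := (bracket_order hj).1
  have hnn : (0 : ℤ) ≤ ordinate j := le_trans (by positivity) h1
  have haz : ordinate j = ((ordinate j).toNat : ℤ) := (Int.toNat_of_nonneg hnn).symm
  have ha' : (ordinate j : ℝ) = ((ordinate j).toNat : ℝ) := by exact_mod_cast haz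
  have ha0 : 0 < (ordinate j).toNat := by
    have : (0 : ℤ) < ((ordinate j).toNat : ℤ) := by
      rw [← haz]; exact lt_of_lt_of_le (by positivity) h1
    exact_mod_cast this
  have h560 := cast_two_pow_560
  unfold t₁ invOrdSqTermHi
  rw [ha', inv_div, Nat.cast_add, Nat.cast_one]
  -- make `a = a_j` and `P = 2²⁴⁰` opaque
  generalize (ordinate j).toNat = a at ha0 ⊢
  clear ha' haz hnn h1
  generalize hP : (2 : ℝ) ^ 240 = P at h560 ⊢
  have ha0' : (0 : ℝ) < a := by exact_mod_cast ha0
  have hP0 : 0 < P := by rw [← hP]; exact pow_pos two_pos 240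
  have ha2 : 0 < a ^ 2 := by positivity
  have hA := cast_div_lt_floor_add_one (2 ^ 560) ha2
  rw [h560, Nat.cast_pow] at hA
  generalize 2 ^ 560 / a ^ 2 = q at hA ⊢
  clear h560 hP
  have e : (P / a) ^ 2 = P ^ 2 * 2 ^ 80 / (a : ℝ) ^ 2 / 2 ^ 80 := by field_simp
  rw [e]
  exact div_le_div_of_nonneg_right hA.le (by positivity)

/-- `invOrdSqTermLo j / 2⁸⁰ ≤ 1/t₂ⱼ²`. [cite: OdlyzkoTeRiele1985, §4.2 p. 151] -/
theorem invOrdSqTermLo_le {j : ℕ} (hj : j < 2000) : (invOrdSqTermLo j : ℝ) / 2 ^ 80 ≤ (t₂ j)⁻¹ ^ 2 := by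
  have h1 := (bracket_order hj).1
  have hnn : (0 : ℤ) ≤ ordinate j := le_trans (by positivity) h1
  have haz : ordinate j = ((ordinate j).toNat : ℤ) := (Int.toNat_of_nonneg hnn).symm
  have ha' : (ordinate j : ℝ) = ((ordinate j).toNat : ℝ) := by exact_mod_cast haz
  have h560 := cast_two_pow_560
  unfold t₂ invOrdSqTermLo
  rw [ha', inv_div]
  generalize (ordinate j).toNat = a
  clear ha' haz hnn h1
  generalize hP : (2 : ℝ) ^ 240 = P at h560 ⊢
  have hP0 : 0 < P := by rw [← hP]; exact pow_pos two_pos 240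
  have hA : ((2 ^ 560 / (a + 1) ^ 2 : ℕ) : ℝ) ≤ ((2 ^ 560 : ℕ) : ℝ) / (((a + 1) ^ 2 : ℕ) : ℝ) :=
    Nat.cast_div_le
  rw [h560, Nat.cast_pow, Nat.cast_add, Nat.cast_one] at hA
  generalize 2 ^ 560 / (a + 1) ^ 2 = q at hA ⊢
  clear h560 hP
  have ha0 : (0 : ℝ) < (a : ℝ) + 1 := Nat.cast_add_one_pos a
  calc (q : ℝ) / 2 ^ 80 ≤ P ^ 2 * 2 ^ 80 / ((a : ℝ) + 1) ^ 2 / 2 ^ 80 :=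
        div_le_div_of_nonneg_right hA (by positivity)
    _ = (P / ((a : ℝ) + 1)) ^ 2 := by field_simp

/-- **`0.02266265500367867088 ≤ Σ_{j<2000} 1/γ_j² ≤ 0.02266265500367867089`**.
[cite: BrentPlattTrudgian2021, §4 Example 1] -/
theorem sum_inv_sq_lowOrdinate_bounds :
    (0.02266265500367867088 : ℝ) ≤ ∑ j ∈ Finset.range 2000, (lowOrdinate j)⁻¹ ^ 2 ∧
      ∑ j ∈ Finset.range 2000, (lowOrdinate j)⁻¹ ^ 2 ≤ 0.02266265500367867089 := by
  obtain ⟨hlo, hhi⟩ := check_eq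
  have hloR : (2266265500367867088 : ℝ) * 2 ^ 80 ≤ (invOrdSqSumLo 2000 : ℝ) * 10 ^ 20 := by
    exact_mod_cast hlo
  have hhiR : (invOrdSqSumHi 2000 : ℝ) * 10 ^ 20 ≤ 2266265500367867089 * 2 ^ 80 := by
    exact_mod_cast hhi
  have h80 : (0 : ℝ) < 2 ^ 80 := by positivity
  -- termwise comparison with the brackets
  have hup : ∑ j ∈ Finset.range 2000, (lowOrdinate j)⁻¹ ^ 2 ≤ (invOrdSqSumHi 2000 : ℝ) / 2 ^ 80 := by
    rw [invOrdSqSumHi_eq, Nat.cast_sum, Finset.sum_div]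
    refine Finset.sum_le_sum fun j hj ↦ ?_
    rw [Finset.mem_range] at hj
    have ht := (lowOrdinate_spec hj).1.1
    have hp := t₁_pos hj
    exact (pow_le_pow_left₀ (inv_nonneg.2 (hp.le.trans ht)) (inv_anti₀ hp ht) 2).trans (inv_t₁_sq_le hj)
  have hdown : (invOrdSqSumLo 2000 : ℝ) / 2 ^ 80 ≤ ∑ j ∈ Finset.range 2000, (lowOrdinate j)⁻¹ ^ 2 := by
    rw [invOrdSqSumLo_eq, Nat.cast_sum, Finset.sum_div]
    refine Finset.sum_le_sum fun j hj ↦ ?_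
    rw [Finset.mem_range] at hj
    have ht := (lowOrdinate_spec hj).1.2
    have hp := (lowOrdinate_pos_lt hj).1
    exact (invOrdSqTermLo_le hj).trans (pow_le_pow_left₀ (inv_nonneg.2 (hp.le.trans ht)) (inv_anti₀ hp ht) 2)
  constructor
  · refine le_trans ?_ hdown
    rw [le_div_iff₀ h80, show (0.02266265500367867088 : ℝ) = 2266265500367867088 / 10 ^ 20 by norm_num,
      div_mul_eq_mul_div, div_le_iff₀ (by positivity)]
    exact hloR
  · refine hup.trans ?_
    rw [div_le_iff₀ h80, show (0.02266265500367867089 : ℝ) = 2266265500367867089 / 10 ^ 20 by norm_num,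
      div_mul_eq_mul_div, le_div_iff₀ (by positivity)]
    exact hhiR

/-- `Σ_{0<γ≤2516} m(ρ)/γ² = Σ_{j<2000} 1/γ_j²` (`N(2516) = 2000`, all these zeros are the simple zeros
`½ + iγ_j`). [cite: OdlyzkoTeRiele1985, §4.2 p. 151] -/
theorem sum_inv_sq_at_heightT0 :
    ∑ ρ ∈ zerosBetween 0 (2516 : ℝ), (riemannZetaZeroOrder ρ : ℝ) / ρ.im ^ 2 =
      ∑ j ∈ Finset.range 2000, (lowOrdinate j)⁻¹ ^ 2 := by
  classical
  have hH : ((heightT0 : ℕ) : ℝ) = 2516 := by norm_num [heightT0]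
  rw [← hH, zerosBetween_zero_heightT0]
  have heinj : Set.InjOn (fun j ↦ (1 / 2 + lowOrdinate j * I : ℂ)) (Finset.range 2000 : Set ℕ) := by
    intro j hj j' hj' h
    exact lowOrdinate_injOn hj hj' (by have := congrArg Complex.im h; simpa using this)
  rw [Finset.sum_image heinj]
  refine Finset.sum_congr rfl fun j hj ↦ ?_
  rw [Finset.mem_range] at hj
  rw [riemannZetaZeroOrder_lowOrdinate hj]
  simp [inv_pow]

/-- **`c₁` to nine digits, in the kernel's arithmetic**: `|c₁ − 0.0231049931| ≤ 4·10⁻¹⁰` (the identity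
`zetaZeroInvSqLimit_eq_at` at `T = 2516` with the certified zeros, `|E₂(2516)| ≤ 3.46·10⁻¹⁰`; the
source: `c₁ = 0.0231049931154189707889338104 + ϑ(5·10⁻²⁸)` from `10¹⁰` zeros).
[cite: BrentPlattTrudgian2021, §4 Example 1 and Corollary 1] -/
theorem abs_zetaZeroInvSqLimit_sub_le : |zetaZeroInvSqLimit - 0.0231049931| ≤ 4e-10 := by
  have hπlo := Real.pi_gt_d20
  have hπhi := Real.pi_lt_d20
  have hπ0 : 0 < π := Real.pi_pos
  have hl2lo := Literature.Analysis.SpecialFunctions.Real.log_two_gt_d20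
  have hl2hi := Literature.Analysis.SpecialFunctions.Real.log_two_lt_d20
  have hlπlo := Literature.Analysis.SpecialFunctions.Real.log_pi_gt_d20
  have hlπhi := Literature.Analysis.SpecialFunctions.Real.log_pi_lt_d20
  obtain ⟨hLlo, hLhi⟩ := HarmonicLimitNumerics.log_2516_bounds
  obtain ⟨hSlo, hShi⟩ := sum_inv_sq_lowOrdinate_bounds
  have hT : 168 * π < (2516 : ℝ) := by linarith
  have h2π : 2 * π ≤ (2516 : ℝ) := by linarith
  -- the identity at T = 2516 and the E₂ bound
  have hid := zetaZeroInvSqLimit_eq_at h2π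
  rw [sum_inv_sq_at_heightT0] at hid
  have hE := abs_two_mul_integral_Ioi_count_sub_countMain_div_cube_le hT
  have hE' : (4.575 + 0.118 * Real.log 2516) / (2516 : ℝ) ^ 3 ≤ 3.46e-10 := by
    rw [div_le_iff₀ (by positivity), show ((2516 : ℝ)) ^ 3 = 15926924096 by norm_num]
    linarith
  -- the logarithm `M = log(2516/2π) = log 2516 − log 2 − log π`
  have hM : Real.log (2516 / (2 * π)) = Real.log 2516 - Real.log 2 - Real.log π := by
    rw [Real.log_div (by norm_num) (by positivity), Real.log_mul (by norm_num) hπ0.ne']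
    ring
  rw [hM, countMain, hM] at hid
  set M : ℝ := Real.log 2516 - Real.log 2 - Real.log π with hMdef
  have hMlo : 5.992548551 ≤ M := by rw [hMdef]; linarith
  have hMhi : M ≤ 5.992548552 := by rw [hMdef]; linarith
  -- `A = (M + 1)/(2π·2516)` and `B = (2000 − L(2516))/2516²` two-sided
  set A : ℝ := (M + 1) / (2 * π * 2516) with hAdef
  have hAlo : 4.42328563e-4 ≤ A := by
    rw [hAdef, le_div_iff₀ (by positivity)]
    nlinarith
  have hAhi : A ≤ 4.42328565e-4 := by
    rw [hAdef, div_le_iff₀ (by positivity)]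
    nlinarith
  set L : ℝ := 2516 / (2 * π) * M - 2516 / (2 * π) + 7 / 8 with hLdef
  have hLlo' : 2000.0603717 ≤ L := by
    rw [hLdef]
    have : 2516 / (2 * π) * M - 2516 / (2 * π) = 2516 * (M - 1) / (2 * π) := by ring
    rw [this, ← sub_le_iff_le_add, le_div_iff₀ (by positivity)]
    nlinarith
  have hLhi' : L ≤ 2000.0603722 := by
    rw [hLdef]
    have : 2516 / (2 * π) * M - 2516 / (2 * π) = 2516 * (M - 1) / (2 * π) := by ring
    rw [this, ← le_sub_iff_add_le, div_le_iff₀ (by positivity)]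
    nlinarith
  have hN : ((zetaZeroCount (2516 : ℝ) : ℕ) : ℝ) = 2000 := by
    have hH : ((heightT0 : ℕ) : ℝ) = 2516 := by norm_num [heightT0]
    rw [← hH, zetaZeroCount_heightT0]
    norm_num
  rw [hN] at hid
  set S : ℝ := ∑ j ∈ Finset.range 2000, (lowOrdinate j)⁻¹ ^ 2 with hSdef
  set E : ℝ := 2 * ∫ t in Ioi (2516 : ℝ), ((zetaZeroCount t : ℝ) - countMain t) / t ^ 3 with hEdef
  have hEabs : |E| ≤ 3.46e-10 := hE.trans hE'
  -- assemble: `c₁ = S + A − (2000 − L)/2516² + E`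
  have hB : zetaZeroInvSqLimit = S + A - (2000 - L) / 2516 ^ 2 + E := by
    rw [hid, hAdef, hLdef]
  rw [abs_le] at hEabs ⊢
  obtain ⟨h1, h2⟩ := hEabs
  rw [hB]
  constructor
  · norm_num at h1 h2 ⊢
    nlinarith
  · norm_num at h1 h2 ⊢
    nlinarith

/-- With no named fact: every truncation `Σ_{0<γ≤U} m(ρ)/γ² < 0.0231049936`.
[cite: BrentPlattTrudgian2021, Corollary 1] -/
theorem sum_inv_sq_lt (U : ℝ) :
    ∑ ρ ∈ zerosBetween 0 U, (riemannZetaZeroOrder ρ : ℝ) / ρ.im ^ 2 < 0.0231049936 := by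
  have h := abs_zetaZeroInvSqLimit_sub_le
  rw [abs_le] at h
  have := sum_inv_sq_le_zetaZeroInvSqLimit U
  linarith [h.2]

/-- The kernel enclosure is consistent with the source's 28-digit value (the named fact
`BrentPlattTrudgian2021_cor1`). [cite: BrentPlattTrudgian2021, Corollary 1] -/
theorem _root_.Literature.NumberTheory.LFunctions.BrentPlattTrudgian2021_cor1.consistent
    (h : BrentPlattTrudgian2021_cor1) :
    |zetaZeroInvSqLimit - BPT2021.c₁| ≤ BPT2021.c₁err ∧ |BPT2021.c₁ - 0.0231049931| ≤ 4e-10 := by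
  refine ⟨BrentPlattTrudgian2021_cor1_iff.1 h, ?_⟩
  rw [BPT2021.c₁]
  norm_num [abs_le]

end InvSqLimitNumerics

end Literature.NumberTheory.LFunctions
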